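/- Copyright: the b2b-balaban cell (near-miss cell 7), T⁴-continuum fan-out; row NE7b ROUND-2 swarm, seat
t4-ne7b-formalise-leaf-06 (gen 7) (road W-RP, sub-row «W-LAB», file 9: NON-VACUITY of the reader witness — the CONSTANT
reader inhabits `ChessboardReaderWitness` on every datum; W7's t5 toy letters BY NAME; INTENT journal l.17482).
Released under the licence of the surrounding project. -/
import Summits.QuantumFields.BalabanUV.T4Continuum.Support.HistoryChessboardReaderWitness
import Summits.QuantumFields.BalabanUV.T4Continuum.Support.HistoryChessboardApexWitness
import Summits.QuantumFields.BalabanUV.T4Continuum.Support.HistoryChessboardGibbsCells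

/-!
# Road W-RP, sub-row «W-LAB», file 9: THE READER WITNESS IS INHABITED (t5-class node test of the SHAPE)

Summits-side support leaf of the T⁴-continuum cell (rung (B)+1 on a FINITE torus only; NOT infinite volume, NOT the
mass gap, NOT the Clay statement; NOT a proof of the spine estimate NE7b).  Row NE7b, road **W-RP**, sub-row «W-LAB»,
file 9 — a DECIDED TOY, the reader-side twin of W6-opt (b) (`HistoryChessboardApexWitness`, leaf-02 g10) and W7-opt
(t5) (`HistoryChessboardGibbsWitness`, leaf-03 g6): file 7's `ChessboardReaderWitness` is INHABITED on EVERY datum with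
measurable averagings, for every run and every loop string whose product observable is identically `1` (the empty
string at every `SU(n)`; every string at `SU(1)`), by the CONSTANT READER (`Λ := Unit`, no bad label, rate `0`): its
pattern type `BlockIdx 4 (cubeCount F 0) → Unit` is a singleton, the one pattern event is the whole tower, and the
DEFINED pattern weight `weight D g₀ os K (patternEv …)` IS the dressed integral `ZOf D g₀ os K t` by W-E1's E1 identity,
so W6-opt's budget (`nuOf`, `exp_nuOf_mul`) and W-2T's zero shells apply BY NAME.  [decided toy] over TREE theorems;
ONE DATA def (`readerWitnessOf`); no `structure`, no `[cite:]` tag, no `Prop`-valued FACT (c1), no constant of print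
(c2∕c6), no exit ∕ socket ∕ `HistoryConstants` ∕ END file touched (c3).

WHAT.  `readerPattern_const` (file 6's FOUR clauses for the constant reader: vacuous ∕ trivial BY DESIGN),
`patternEv_const_eq_univ`, **`weight_patternEv_const`** (`weight … (patternEv hm₁ K (fun _ => ())) t p = ZOf D g₀ os K t` —
E1), **`readerWitnessOf D hM hobs : ChessboardReaderWitness D g₀ os Unit 0`**, `nonempty_readerWitness_of_prodObs`,
`nonempty_readerWitness_nil`, `forSmallCouplings_readerWitness` (subsingleton gauge group: file 7's headline binder
`hData` VERBATIM), and two `example`s: file 7's per-witness END fires for the empty string at `SU(n)`, the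
four targets fire at `SU(1)` (same statements as W7-opt's `stringHybridNE7_nil_fires` ∕ `targets_fire_SU1`, reader route).

HONEST SCOPE.  A node test of the SHAPE only: the constant reader reads NOTHING (no bad label), so every located clause
is vacuous and the toy says nothing about Bałaban's large-field classes; over `SU(1)` ∕ the empty string the targets are
physically empty.  For `SU(n)`, `n ≥ 2`, and a non-trivial string the displayed reader witness IS the content of road W.
Nothing of H3 ∕ (B) ∕ BetaPertH ∕ NE7c ∕ NE7 discharged; 0∕9 unchanged.  NE7b NOT proved; spine 0∕9.  HONEST DEPENDENCY
(cell): continuum YM on T⁴ ⇐ BetaPertH ∧ nine spine estimates (0/9 proved); BetaPertH ⇐ (D1) ∧ (D4) ∧ CAP+tail;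
G-an2-4 gates asym, D1 and NE2/3/4.  This file changes none of it.
-/

open Finset MeasureTheory
open Literature.Barriers.CriticalPhenomena.NonGibbs
open Literature.MathematicalPhysics.QuantumFieldTheory.Balaban1983to89
open Literature.MathematicalPhysics.QuantumFieldTheory.Balaban1983to89.Missing
open Literature.MathematicalPhysics.QuantumFieldTheory.Balaban1983to89.T4Continuum
open Literature.MathematicalPhysics.QuantumFieldTheory.Balaban1983to89.T4MatchingClosure
open Summit.QuantumFields.BalabanUV.T4Continuum
open HistoryRPTowerLaw HistoryRPTowerCuts HistoryRPTowerTemplates HistoryRPTowerUniform HistoryChessboardEventsCubes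
open HistoryChessboardEventsTemplates HistoryChessboardTowerRepr HistoryChessboardGibbsSide HistoryChessboardGibbs
open HistoryChessboardLabelsPattern HistoryChessboardReaderWitness HistoryChessboardApexWitness HistoryChessboardGibbsCells
open HistoryRealiseCellsRunApexWitness HistoryRealiseCellsRunApexWitnessData

namespace Summit.QuantumFields.BalabanUV.T4Continuum.HistoryChessboardReaderWitnessToy

noncomputable section

/-! ## §1 The constant reader: four clauses, one pattern, weight = the dressed integral -/

section Const

variable {F : T4Family} {G : Type} [GaugeGroup G] [MeasurableSpace G] [HaarData G]

/-- **THE CONSTANT READER SATISFIES FILE 6's FOUR CLAUSES** on any datum, run and cutoff (no bad label, rate `0`):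
`read_meas` — a fibre of a constant map is the whole tower; `read_sym` — `rfl`; `univ_le` — vacuous. [decided toy] -/
theorem readerPattern_const (D : FiniteEpsData F G) (g₀ : ℕ → ℝ) {m₁ : ℕ} (hm₁ : m₁ ≤ F.m) (K : ℕ) :
    GibbsReaderPattern D g₀ hm₁ K (∅ : Finset Unit) (fun _ : Tower (F.P K) G K => ()) 0 where
  read_meas l := by
    rw [Set.preimage_const_of_mem (Set.mem_singleton_iff.2 (Subsingleton.elim _ _))]
    exact MeasurableSet.univ
  read_sym _ _ := rfl
  univ_le _ h := (Finset.notMem_empty _ h).elim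
  r_nonneg := le_rfl

omit [GaugeGroup G] [MeasurableSpace G] [HaarData G] in
/-- the ONE pattern event of the constant reader is the whole tower (the pattern type is a singleton). [decided toy] -/
theorem patternEv_const_eq_univ {m₁ : ℕ} (hm₁ : m₁ ≤ F.m) (K : ℕ) (p : BlockIdx 4 (cubeCount F m₁) → Unit) :
    patternEv hm₁ K (fun _ : Tower (F.P K) G K => ()) p = Set.univ :=
  Set.eq_univ_of_forall fun _ => (Subsingleton.elim _ _ : patternOf hm₁ K (fun _ : Tower (F.P K) G K => ()) _ = p)

variable [RegularGaugeGroup G]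

/-- **THE DEFINED PATTERN WEIGHT OF THE CONSTANT READER IS THE DRESSED INTEGRAL** `ZOf D g₀ os K t` — W-E1's E1 identity
`integral_exp_mul_prodObs_dens_zero` on the whole tower. [decided toy] -/
theorem weight_patternEv_const (D : FiniteEpsData F G) (hM : D.AvgMeasurable) (g₀ : ℕ → ℝ) (os : List (ULoop F))
    {m₁ : ℕ} (hm₁ : m₁ ≤ F.m) (K : ℕ) (t : ℝ) (p : BlockIdx 4 (cubeCount F m₁) → Unit) :
    weight D g₀ os K (patternEv hm₁ K (fun _ : Tower (F.P K) G K => ())) t p = ZOf D g₀ os K t := by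
  rw [weight, patternEv_const_eq_univ, setIntegral_univ]
  exact (integral_exp_mul_prodObs_dens_zero D hM g₀ K os t).symm

end Const

/-! ## §2 The reader witness term: every datum, every run, every string with trivial product observable -/

section Witness

variable {F : T4Family} {G : Type} [GaugeGroup G] [MeasurableSpace G] [HaarData G] [RegularGaugeGroup G]

/-- **THE READER WITNESS TERM** on ANY datum `D` with measurable averagings, for any run `g₀` and any string `os` whose
product observable is identically `1`: the constant reader at every cutoff (cubes of side `L^0`), no bad label, zero
rates, zero shells (W-2T's `shellWeightBound_zero_of_nonneg` on the nonnegative DEFINED weights), W6-opt's NE7 budget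
with equality (`Cc := nuOf`, `ν := nuOf`, everything else `0`; `exp_nuOf_mul` after `weight_patternEv_const`),
`l₀ = vol = 1`, `K₀ = 0`. [decided toy] -/
def readerWitnessOf (D : FiniteEpsData F G) (hM : D.AvgMeasurable) {g₀ : ℕ → ℝ} {os : List (ULoop F)}
    (hobs : ∀ (K : ℕ) (U : GaugeField (F.P K) 0 G), T4GenFunBounds.prodObs (D.scheme g₀) K os U = 1) :
    ChessboardReaderWitness D g₀ os Unit 0 where
  hm₁ := Nat.zero_le _
  l₀ := 1
  vol := 1
  l₀_pos := one_pos
  vol_pos := one_pos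
  K₀ := 0
  P := ∅
  f := fun _ _ => ()
  f' := fun _ _ => ()
  r := fun _ => 0
  r' := fun _ => 0
  patA := fun K _ => readerPattern_const D g₀ (Nat.zero_le _) K
  patB := fun K _ => readerPattern_const D g₀ (Nat.zero_le _) (K + 1)
  sum_r := summable_zero
  sum_r' := summable_zero
  shA := fun _ _ _ => 0
  shB := fun _ _ _ => 0
  Cc := fun K _ _ => nuOf D g₀ os K
  Rr := fun _ _ _ => 0
  CcRec := fun _ _ _ => 0
  RrRec := fun _ _ _ => 0
  ν := nuOf D g₀ os
  u := fun _ => 0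
  s₂ := fun _ => 0
  c₀ := fun _ => 0
  rr := fun _ => 0
  s := fun _ => 0
  Wsh := fun _ => 0
  shell := shellWeightBound_zero_of_nonneg (fun K t p _ => weight_nonneg D g₀ os K _ t p)
    (fun K t p _ => weight_nonneg D g₀ os (K + 1) _ t p)
  budget :=
    { nonneg := fun K t _ p _ => by simpa only [sub_zero] using weight_nonneg D g₀ os K _ t p
      lower := fun K t _ p _ => by
        simpa only [sub_zero, weight_patternEv_const D hM] using (exp_nuOf_mul hobs K t).le
      upper := fun K t _ p _ => by
        simpa only [sub_zero, add_zero, weight_patternEv_const D hM] using (exp_nuOf_mul hobs K t).ge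
      uv_const := fun _ _ _ _ _ => by simp
      uv_radius := fun _ _ _ _ _ => by simp
      recent_remainder := fun _ _ _ _ _ => by simp
      recent_deviation := fun _ _ _ _ _ => by simp }
  sum_rr := summable_zero
  sum_u := summable_zero
  sum_s := summable_zero
  sum_s₂ := summable_zero

/-- The toy keeps W6-opt's ∕ W7-opt's window and threshold (`l₀ = vol = 1`, `K₀ = 0`), definitionally. [decided toy] -/
example (D : FiniteEpsData F G) (hM : D.AvgMeasurable) {g₀ : ℕ → ℝ} {os : List (ULoop F)}
    (hobs : ∀ (K : ℕ) (U : GaugeField (F.P K) 0 G), T4GenFunBounds.prodObs (D.scheme g₀) K os U = 1) :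
    (readerWitnessOf D hM hobs).l₀ = 1 ∧ (readerWitnessOf D hM hobs).vol = 1 ∧ (readerWitnessOf D hM hobs).K₀ = 0 :=
  ⟨rfl, rfl, rfl⟩

/-- **THE SHAPE IS INHABITED on ANY datum with measurable averagings, for any run and any string with trivial product
observable.** [decided toy] -/
theorem nonempty_readerWitness_of_prodObs (D : FiniteEpsData F G) (hM : D.AvgMeasurable) {g₀ : ℕ → ℝ}
    {os : List (ULoop F)}
    (hobs : ∀ (K : ℕ) (U : GaugeField (F.P K) 0 G), T4GenFunBounds.prodObs (D.scheme g₀) K os U = 1) :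
    Nonempty (ChessboardReaderWitness D g₀ os Unit 0) :=
  ⟨readerWitnessOf D hM hobs⟩

/-- **… IN PARTICULAR FOR THE EMPTY STRING: ANY datum with measurable averagings, ANY regular gauge group, ANY run.**
[decided toy] -/
theorem nonempty_readerWitness_nil (D : FiniteEpsData F G) (hM : D.AvgMeasurable) (g₀ : ℕ → ℝ) :
    Nonempty (ChessboardReaderWitness D g₀ ([] : List (ULoop F)) Unit 0) :=
  nonempty_readerWitness_of_prodObs D hM fun K U => prodObs_nil G (D.scheme g₀) K U

end Witness

/-! ## §3 Over a subsingleton gauge group: every string; file 7's headline binder verbatim -/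

section Subsingleton

variable {F : T4Family} {G : Type} [GaugeGroup G] [MeasurableSpace G] [HaarData G] [RegularGaugeGroup G]
  [Subsingleton G]

/-- over a subsingleton gauge group the reader witness is inhabited for EVERY datum with measurable averagings, run and
string (`prodObs_eq_one`). [decided toy] -/
theorem nonempty_readerWitness (D : FiniteEpsData F G) (hM : D.AvgMeasurable) (g₀ : ℕ → ℝ) (os : List (ULoop F)) :
    Nonempty (ChessboardReaderWitness D g₀ os Unit 0) :=
  nonempty_readerWitness_of_prodObs D hM fun K U => prodObs_eq_one D g₀ K os U

/-- **FILE 7's HEADLINE BINDER `hData` HOLDS, VERBATIM, for EVERY datum with measurable averagings over a subsingleton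
gauge group** (`ForSmallCouplings.of_forall`). [decided toy] -/
theorem forSmallCouplings_readerWitness (D : FiniteEpsData F G) (hM : D.AvgMeasurable) :
    T4ContinuumYM4Torus.ForSmallCouplings D fun g₀ => ∀ os : List (ULoop F),
      ∃ (Λ : Type) (_ : Fintype Λ) (_ : DecidableEq Λ) (m₁ : ℕ), Nonempty (ChessboardReaderWitness D g₀ os Λ m₁) :=
  T4ContinuumYM4Torus.ForSmallCouplings.of_forall fun g₀ os =>
    ⟨Unit, inferInstance, inferInstance, 0, nonempty_readerWitness D hM g₀ os⟩

end Subsingleton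

/-! ## §4 File 7's ENDs fire on the toy (plumbing tests) -/

section SUn

variable {F : T4Family} {n : ℕ} [NeZero n] {ℰ : LoopAverage (Matrix.specialUnitaryGroup (Fin n) ℂ)}

/-- **FILE 7's PER-WITNESS END FIRES FOR THE EMPTY STRING AT EVERY `SU(n)`** (`stringHybridNE7_of_readerWitness` APPLIED
to `readerWitnessOf`; physically empty — a plumbing test).  As a FACT this is W7-opt's `stringHybridNE7_nil_fires`
(p229713) — kept an `example` (same statement, the READER route exercised). [decided toy] -/
example (D : FiniteEpsData F (Matrix.specialUnitaryGroup (Fin n) ℂ))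
    (hBA : D.IsBlockAveraged ℰ) (hE : ℰ.MeasurableE) (g₀ : ℕ → ℝ) :
    ∃ K, 0 ≤ K ∧ T4MatchingAssembly.StringHybridNE7 (D.scheme g₀) ([] : List (ULoop F)) 1 1 K :=
  stringHybridNE7_of_readerWitness hBA hE
    (readerWitnessOf D (hBA.avgMeasurable hE) fun K U => prodObs_nil _ (D.scheme g₀) K U)

end SUn

section SU1

variable {F : T4Family} {ℰ : LoopAverage (Matrix.specialUnitaryGroup (Fin 1) ℂ)}

/-- **THE FOUR PREFIXED T⁴ TARGETS FIRE at `SU(1)` THROUGH THE READER WITNESS** (`targets_of_readerWitness_fsc` APPLIED;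
no pin is an input).  Over the TRIVIAL group a test of the PLUMBING end to end, physically empty; it says nothing about
`SU(n)`, `n ≥ 2`.  As a FACT this is W7-opt's `targets_fire_SU1` (p229713) ∕ W6-opt's — kept an `example` (same statement,
the READER route exercised). [decided toy] -/
example (D : FiniteEpsData F (Matrix.specialUnitaryGroup (Fin 1) ℂ))
    (hBA : D.IsBlockAveraged ℰ) (hE : ℰ.MeasurableE) :
    D.ym4_torus_continuum_limit_exists ∧ D.ym4_torus_continuum_limit_unique ∧ D.limit_reflectionPositive ∧
      D.limit_torusCovariant :=
  haveI := subsingleton_SU1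
  targets_of_readerWitness_fsc D hBA hE (forSmallCouplings_readerWitness D (hBA.avgMeasurable hE))

end SU1

end

end Summit.QuantumFields.BalabanUV.T4Continuum.HistoryChessboardReaderWitnessToy
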